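import Summits.QuantumFields.YangMills.Theorems.UnitScaleTiltProp7CornerCombH21ELambdaPricing
import Summits.QuantumFields.YangMills.Theorems.UnitScaleTiltProp7CellBoxMultiplicity
import HarnessLib

/-!
# (n3)-COMB (II), row `hMcomb₂`, H2-1(E) member knit, file M-3 (proper) part 0 «COUNTS» — READING RADII, THE VOLUME RATIO AT THE UNIFORM BIG BOX,
# AND THE CORNER-FAMILY COUNT WITH BOUNDED MULTIPLICITY (no factor `N_l`)

Crux `stmt-QuantumFields-19200` `Summit.QuantumFields.YangMills.Theses.UnitScaleTilt.MinimiserStabilityRegPr`, route-R E′ (A′)-on-Σ, P-A2 (β); row `hMcomb₂` ⟸ H2-1(E)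
(★px17 H-3c ✓p714849 ∕ H-4b: `hMcomb₂` ⟸ per-(l, j) `ℓ¹` bounds of the cornered propagators on tied sources + the level-0 defect).  px18 g4 LOCATE «H2-1(E) SUPPLIER — THE MEMBER
KNIT SKELETON OVER THE LANDED ℓ¹ KIT» (19200 evidence 2686e4bb) §2 «M-3»; seam (β) with ★px17 g5 (the MEMBER instantiation at `RegPr` is M-4b, not here); v2 after ★px17 g5's
located `(1 + N_l³)` volume leak (bus 2026-08-29 11:25:01Z): the Λ boxes are priced with the UNIFORM big box `Rb := s·(L+4)` (`s` = corner spacing) and counted over the corner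
FAMILY with bounded multiplicity (✓F-6d-1), so every currency is extensive ONCE.  Cell `ym3-torus`, width seat `ym-ust-20520-w3` (gen 12);
`--kind proof --supports stmt-QuantumFields-19200 --as helper`; THEOREMS ONLY (0 `def`, 0 `sorry`); «(O2) groundwork»; count-neutral.

THE POINT.  In the Λ-sector of the `ℓ¹` knit every level-`l` corner `z` reads the tied source on a box `box (Lⁿ•z) ρᵢ` (`ρᵢ = Lⁱ(L+4) − 4`), priced by ✓D's Hardy row against a
BIG box around the dilated corner `s•z` (`s = L^{n+1}`).  Pricing against a PERIOD-sized big box and multiplying by the number of corners (✓M-2 §3∕§4) makes the norm-gap currency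
extensive twice (★px17 g5's located leak).  Here instead: the big radius is the UNIFORM `Rb := s·(L+4)` — large enough for every `i < n` (`lift_rad_le`∕`rad_le`, third conjuncts),
small enough that the family `{box (s•z) Rb}_z` covers one fine period cell at most `2ᵈ·(2L+9)ᵈ` times (★ `sum_box_sum_box_le_cell` = ✓M-2 §1 `sum_box_le_pow_mul_sum_cell_of_periodic`
on the `N_l`-periodic box-sum + ✓F-6d-1 `Prop7CellBoxMultiplicity.sum_cell_sum_box_shift_le` + ✓M-2 `sum_box_centred_eq_sum_boxVec`), and the volume ratio is EXACTLY the
real-assembly monomial: `(2ρ+1)³∕(2Rb+1)³ ≤ (L³)^q·((L³)^p)⁻¹` (`ratio_pow_le`).  Consumers: parts 1–2 (`…H21ETiedLevelRows`, `…H21ELevelZeroRows`).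

WHAT IS PROVED (ns `…Theorems.Prop7CornerCombH21ECounts`; all `theorem`s): `rad_nonneg`, `lift_rad_le`, `rad_le` (the radii letters), `ratio_pow_le`, `pow_ratio_succ`
(pure reals), ★ `sum_box_sum_box_le_cell` (the corner-family count, any `d`).

HONEST SCOPE.  Finite-sum ∕ real-inequality bookkeeping over landed and signed rows; every analytic input is a displayed hypothesis.  Nothing of H2-1's member,
`hMcomb₂`, `hMcomb`, (G_j), (β), `hD`, EX `stub_existenceMinimalOrbit`, the crux `MinimiserStabilityRegPr`, or any summit statement is proved or claimed here.
YM₃ on T³ is ladder rung R3 (HUMAN RULING D-0037) — NOT d = 4, NOT infinite volume, NOT a mass gap, NOT the Clay problem; the YM mass gap is NOT proved.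

References: T. Bałaban, «Averaging operations for lattice gauge theories», CMP **98** (1985) 17–51 [Balaban1985Averaging] ((2) p.17, (42)–(43) pp.23–24, (124)–(126) p.36);
T. Bałaban, «The variational problem and background fields in renormalization group method for lattice gauge theories», CMP **102** (1985) 277–309 [Balaban1985Variational] (Prop. 7 p.299);
M. Giaquinta, *Multiple integrals in the calculus of variations and nonlinear elliptic systems* (1983) [Giaquinta1984] (Ch. III §1 pp.64–72).
-/

set_option autoImplicit false

noncomputable section

open Finset
open scoped BigOperators

namespace Summit.QuantumFields.YangMills.Theorems.Prop7CornerCombH21ECounts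

open Literature.MathematicalPhysics.QuantumFieldTheory.Balaban1983to89
open B7Prop1Explicit (Site e boxVec)
open B4Eq19LatticeOperators (box sum_box_add_right)
open Summit.QuantumFields.YangMills.Theorems.Prop7CellBoxMultiplicity (sum_cell_sum_box_shift_le)
open Summit.QuantumFields.YangMills.Theorems.Prop7CornerCombH21ELambdaPricing (sum_box_le_pow_mul_sum_cell_of_periodic sum_box_centred_eq_sum_boxVec)

/-! ## §1 The radii, the ratio, the corner-family count -/

section Letters

variable {d : ℕ}

/-- The reading radii: `ρ i := Lⁱ(L+4) − 4 ≥ 0` for `1 ≤ L`. [folklore] -/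
theorem rad_nonneg (L : ℕ) (hL : 1 ≤ L) (i : ℕ) : 0 ≤ (L : ℤ) ^ i * (L + 4) - 4 := by
  have h1 : (1 : ℤ) ≤ (L : ℤ) ^ i := one_le_pow₀ (by exact_mod_cast hL)
  have h2 : (5 : ℤ) ≤ (L : ℤ) + 4 := by
    have : (1:ℤ) ≤ L := by exact_mod_cast hL
    linarith
  nlinarith

/-- The lifted reading radii `ρ₁ = L·ρᵢ + 2L`: `2ρ₁ + 1 ≤ 2(L+4)·L^{i+1}`, `ρ₁ + 1 ≤ (L+4)·L^{i+1}` and `ρ₁ ≤ (L+4)·L^{n+1}` for `i ≤ n` (reals, `1 ≤ L`). [folklore] -/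
theorem lift_rad_le (L : ℕ) (hL : 1 ≤ L) {i n : ℕ} (hin : i ≤ n) :
    (2 * ((L : ℝ) * ((L : ℝ) ^ i * (L + 4) - 4) + 2 * L) + 1 ≤ 2 * ((L : ℝ) + 4) * (L : ℝ) ^ (i + 1)) ∧
    ((L : ℝ) * ((L : ℝ) ^ i * (L + 4) - 4) + 2 * L + 1 ≤ ((L : ℝ) + 4) * (L : ℝ) ^ (i + 1)) ∧
    ((L : ℝ) * ((L : ℝ) ^ i * (L + 4) - 4) + 2 * L ≤ (L : ℝ) ^ (n + 1) * (L + 4)) := by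
  have hL' : (1 : ℝ) ≤ L := by exact_mod_cast hL
  have e : (L : ℝ) * ((L : ℝ) ^ i * (L + 4) - 4) + 2 * L = ((L : ℝ) + 4) * (L : ℝ) ^ (i + 1) - 2 * L := by ring
  have hmono : (L : ℝ) ^ (i + 1) ≤ (L : ℝ) ^ (n + 1) := pow_le_pow_right₀ hL' (by omega)
  rw [e]
  refine ⟨by linarith, by linarith, ?_⟩
  nlinarith

/-- The untied reading radii `ρᵢ = Lⁱ(L+4) − 4`: `2ρᵢ + 1 ≤ 2(L+4)·Lⁱ`, `ρᵢ + 1 ≤ (L+4)·Lⁱ` and `ρᵢ ≤ (L+4)·Lⁿ` for `i ≤ n` (reals, `1 ≤ L`). [folklore] -/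
theorem rad_le (L : ℕ) (hL : 1 ≤ L) {i n : ℕ} (hin : i ≤ n) :
    (2 * ((L : ℝ) ^ i * (L + 4) - 4) + 1 ≤ 2 * ((L : ℝ) + 4) * (L : ℝ) ^ i) ∧
    (((L : ℝ) ^ i * (L + 4) - 4) + 1 ≤ ((L : ℝ) + 4) * (L : ℝ) ^ i) ∧
    (((L : ℝ) ^ i * (L + 4) - 4) ≤ (L : ℝ) ^ n * (L + 4)) := by
  have hL' : (1 : ℝ) ≤ L := by exact_mod_cast hL
  have hmono : (L : ℝ) ^ i ≤ (L : ℝ) ^ n := pow_le_pow_right₀ hL' hin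
  refine ⟨by linarith [mul_comm ((L : ℝ) ^ i) ((L : ℝ) + 4)], by linarith [mul_comm ((L : ℝ) ^ i) ((L : ℝ) + 4)], ?_⟩
  nlinarith

/-- THE VOLUME RATIO AT THE UNIFORM BIG BOX (pure reals): `0 ≤ 2ρ+1 ≤ 2(L+4)·L^q` and `2(L+4)·L^p ≤ 2Rb+1` (`0 < L`) give
`(2ρ+1)³∕(2Rb+1)³ ≤ (L³)^q·((L³)^p)⁻¹`. [folklore] -/
theorem ratio_pow_le {L ρ Rb : ℝ} (hL : 0 < L) {p q : ℕ} (hρ0 : 0 ≤ 2 * ρ + 1) (hρ : 2 * ρ + 1 ≤ 2 * (L + 4) * L ^ q)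
    (hRb : 2 * (L + 4) * L ^ p ≤ 2 * Rb + 1) :
    (2 * ρ + 1) ^ 3 / (2 * Rb + 1) ^ 3 ≤ (L ^ 3) ^ q * ((L ^ 3) ^ p)⁻¹ := by
  have hden : 0 < 2 * (L + 4) * L ^ p := by positivity
  have hRb0 : 0 < 2 * Rb + 1 := lt_of_lt_of_le hden hRb
  rw [div_le_iff₀ (pow_pos hRb0 3)]
  have h1 : (2 * ρ + 1) ^ 3 ≤ (2 * (L + 4) * L ^ q) ^ 3 := pow_le_pow_left₀ hρ0 hρ 3
  have h2 : (2 * (L + 4) * L ^ p) ^ 3 ≤ (2 * Rb + 1) ^ 3 := pow_le_pow_left₀ hden.le hRb 3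
  have hLp : 0 < (L ^ 3) ^ p := by positivity
  have e3 : (L ^ 3) ^ q = (L ^ q) ^ 3 := by rw [← pow_mul, ← pow_mul, mul_comm]
  have e4 : (L ^ 3) ^ p = (L ^ p) ^ 3 := by rw [← pow_mul, ← pow_mul, mul_comm]
  have hLp3 : (L ^ p) ^ 3 ≠ 0 := by positivity
  have e : (L ^ 3) ^ q * ((L ^ 3) ^ p)⁻¹ * (2 * (L + 4) * L ^ p) ^ 3 = (2 * (L + 4) * L ^ q) ^ 3 := by
    rw [e3, e4]; field_simp
  have h0 : 0 ≤ (L ^ 3) ^ q * ((L ^ 3) ^ p)⁻¹ := by positivity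
  calc (2 * ρ + 1) ^ 3 ≤ (2 * (L + 4) * L ^ q) ^ 3 := h1
    _ = (L ^ 3) ^ q * ((L ^ 3) ^ p)⁻¹ * (2 * (L + 4) * L ^ p) ^ 3 := e.symm
    _ ≤ (L ^ 3) ^ q * ((L ^ 3) ^ p)⁻¹ * (2 * Rb + 1) ^ 3 := mul_le_mul_of_nonneg_left h2 h0

/-- `(L³)^q·((L³)^p)⁻¹ = (L³)^(q+1)·((L³)^(p+1))⁻¹` (`L ≠ 0`). [folklore] -/
theorem pow_ratio_succ {L : ℝ} (hL : L ≠ 0) (p q : ℕ) :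
    (L ^ 3) ^ q * ((L ^ 3) ^ p)⁻¹ = (L ^ 3) ^ (q + 1) * ((L ^ 3) ^ (p + 1))⁻¹ := by
  have h3 : L ^ 3 ≠ 0 := pow_ne_zero 3 hL
  have hp : (L ^ 3) ^ p ≠ 0 := pow_ne_zero p h3
  rw [pow_succ (L ^ 3) q, pow_succ (L ^ 3) p, mul_inv]
  field_simp

/-- ★ **THE CORNER-FAMILY COUNT (bounded multiplicity).**  For an `Nj`-periodic `f ≥ 0` on `ℤᵈ` with `Nj = N_l·s`, the big boxes of radius `s·r` centred at the DILATED
corners `s•(z + v)`, `z` running over a centred box `box c R` covering one corner cell at most twice per direction (`2R+1 ≤ 2N_l`), read the fine cell at most `2ᵈ·Aᵈ` times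
whenever `2(s·r)+1 ≤ A·s`: `Σ_{z∈box c R} Σ_{x∈box (s•(z+v)) (s·r)} f x ≤ 2ᵈ·Aᵈ·Σ_{y∈[0,Nj)ᵈ} f y` — NO factor `N_l`.  (✓M-2 `sum_box_le_pow_mul_sum_cell_of_periodic` folds the
`z`-sum of the `N_l`-PERIODIC box-sum onto one corner cell; ✓F-6d-1 `sum_cell_sum_box_shift_le` counts the family; the centred box is re-cornered by ✓M-2
`sum_box_centred_eq_sum_boxVec`.) [cite: Balaban1985Averaging, (2) p.17, (125)-(126) p.36; Giaquinta1984, Ch. III §1 p.70] -/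
theorem sum_box_sum_box_le_cell (Nl s r A : ℕ) [NeZero Nl] (hs : 1 ≤ s) (hA : 2 * (s * r) + 1 ≤ A * s)
    (Nj : ℕ) (hNj : Nj = Nl * s) (f : Site d → ℝ) (hf : ∀ y, 0 ≤ f y)
    (hfp : ∀ (y : Site d) (κ : Fin d), f (y + (Nj : ℤ) • e κ) = f y) (c : Site d) (R : ℕ) (hR : 2 * R + 1 ≤ 2 * Nl) (v : Site d) :
    ∑ z ∈ box c (R : ℤ), ∑ x ∈ box ((s : ℤ) • (z + v)) ((s * r : ℕ) : ℤ), f x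
      ≤ (2 : ℝ) ^ d * ((A : ℝ) ^ d * ∑ y : Fin d → Fin Nj, f (boxVec Nj y)) := by
  -- the box sum as a function of the (undilated) corner is nonnegative and `Nl`-periodic
  set h : Site d → ℝ := fun z => ∑ x ∈ box ((s : ℤ) • (z + v)) ((s * r : ℕ) : ℤ), f x with hh
  have hh0 : ∀ z, 0 ≤ h z := fun z => Finset.sum_nonneg fun x _ => hf x
  have hhp : ∀ (z : Site d) (κ : Fin d), h (z + (Nl : ℤ) • e κ) = h z := by
    intro z κ
    have e1 : (s : ℤ) • (z + (Nl : ℤ) • e κ + v) = (s : ℤ) • (z + v) + (Nj : ℤ) • e κ := by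
      rw [hNj]; push_cast
      rw [show z + (Nl : ℤ) • e κ + v = (z + v) + (Nl : ℤ) • e κ by abel, smul_add, smul_smul, mul_comm (s : ℤ) (Nl : ℤ)]
    show ∑ x ∈ box ((s : ℤ) • (z + (Nl : ℤ) • e κ + v)) ((s * r : ℕ) : ℤ), f x = ∑ x ∈ box ((s : ℤ) • (z + v)) ((s * r : ℕ) : ℤ), f x
    rw [e1, ← sum_box_add_right]
    exact Finset.sum_congr rfl fun x _ => hfp x κ
  -- fold the `z`-sum onto one corner cell (multiplicity `2ᵈ`)
  have h1 := sum_box_le_pow_mul_sum_cell_of_periodic Nl 2 h hh0 hhp c R hR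
  -- count the corner family (multiplicity `Aᵈ`)
  have h2 : ∑ t : Fin d → Fin Nl, h (boxVec Nl t) ≤ (A : ℝ) ^ d * ∑ y : Fin d → Fin Nj, f (boxVec Nj y) := by
    have h3 := sum_cell_sum_box_shift_le Nl s (2 * (s * r) + 1) A hs hA Nj hNj f hf hfp (v - fun _ => (r : ℤ))
    refine le_of_eq_of_le (Finset.sum_congr rfl fun t _ => ?_) h3
    show ∑ x ∈ box ((s : ℤ) • (boxVec Nl t + v)) ((s * r : ℕ) : ℤ), f x = _
    rw [sum_box_centred_eq_sum_boxVec]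
    refine Finset.sum_congr rfl fun u _ => ?_
    have ev : ((s : ℤ) • (boxVec Nl t + v) - fun _ => ((s * r : ℕ) : ℤ)) = (s : ℤ) • (boxVec Nl t + (v - fun _ => (r : ℤ))) := by
      funext i
      simp only [Pi.sub_apply, Pi.smul_apply, Pi.add_apply, smul_eq_mul]
      push_cast; ring
    rw [ev, add_comm]
  have h2' : (0 : ℝ) ≤ (2 : ℝ) ^ d := by positivity
  calc ∑ z ∈ box c (R : ℤ), h z ≤ (2 : ℝ) ^ d * ∑ t : Fin d → Fin Nl, h (boxVec Nl t) := by exact_mod_cast h1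
    _ ≤ (2 : ℝ) ^ d * ((A : ℝ) ^ d * ∑ y : Fin d → Fin Nj, f (boxVec Nj y)) := mul_le_mul_of_nonneg_left h2 h2'

end Letters


end Summit.QuantumFields.YangMills.Theorems.Prop7CornerCombH21ECounts

end
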